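import Summits.FinalStateConjecture.FinalStateConjecture.Theorems.EIHFluxBalanceInertialRecessionStubSlaving3Dilate
import Literature.Geometry.Lorentzian.CoordRicciJet

/-!
# Route EIHFluxBalance — `InertialRecession` (E′), line `SketchCleanExcision`:
# jet calculus for the coordinate Ricci form — zooming, the chain rule through the Ricci jet
# function, and uniform local Lipschitz bounds near compact jet sets (slaving stub `stub_slaving`)

Helper file for the crux `stmt-FinalStateConjecture-17403`
(`Summit.FinalStateConjecture.FinalStateConjecture.Theses.EIHFluxBalance.InertialRecession`, E′),
stub `stub_slaving`. Generic tools (finite-dimensional `E`) for the `C²`/`C³` relative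
Ricci-smallness capstone of the slaving analysis (companion file `…StubSlaving12RelRicci`), which
reads the vacuum equations `Ric(e + g₀) = 0`, `D Ric(e + g₀) = 0` of the lab metric against the
frozen ansatz `g₀` with UNBOUNDED jets by ZOOMING (`ψ(w) = x + c w`, `c = 1/λ`): the zoomed fields
have jets `(G(x), c DG, c² D²G, c³ D³G)` at `0`, which lie in a fixed compact jet set, where the
Ricci jet function `MetricCoord.ricciJet` (`CoordRicciJet.lean`) and its derivative are bounded and
Lipschitz; the factors `c⁻²`, `c⁻³` restore the parabolic degrees.

* `hasFDerivAt_zoom`, `isMetricOn_comp_zoom`, `ricAt_comp_zoom` (`Ric(G ∘ ψ)(z) = c² Ric(G)(ψ z)`),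
  `fderiv_ricAt_comp_zoom` (`D[Ric(G ∘ ψ)](0) = c³ D[Ric G](x)`) — the affine analogue of
  `…StubSlaving3Dilate` with base point `0`;
* `fderiv_comp_zoom`, `fderiv_fderiv_comp_zoom_of_mem`, `fderiv_fderiv_fderiv_comp_zoom`,
  `jets_comp_zoom` — the jets of `H ∘ ψ`: `D(H ∘ ψ)(z) = c DH(ψ z)`, `D²(H ∘ ψ)(0) = c² D²H(x)`,
  `D³(H ∘ ψ)(0) = c³ D³H(x)`; `fderiv_add_jets` — jets of a sum up to order three;
* `hasFDerivAt_jetMap`, `fderiv_ricAt_eq_comp_jetMap` — `D[Ric G](x) = D(ricciJet)(j₂G(x)) ∘ Dj₂G(x)`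
  with `Dj₂G(x) v = (v, DG v, D²G v, D³G v)`, and the norms of such jet maps
  (`norm_jetCLM_le`, `norm_jetCLM_sub_le`);

The compactness half (uniform local Lipschitz bounds near a compact jet set, the compact box of
coercive forms, late-time coercivity of the ansatz) is the companion file `…StubSlaving12JetCompact`.
Elementary; no definitions, no named facts.
-/

set_option linter.dupNamespace false
set_option maxSynthPendingDepth 3

noncomputable section

open scoped Topology ContDiff
open Filter Set Function Literature.Geometry.Lorentzian Literature.Geometry.Lorentzian.MetricCoord

namespace Summit.FinalStateConjecture.FinalStateConjecture.Theorems.SublinearIsFree.Slaving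

/-! ### Zooming: the affine maps `ψ(w) = x + c w` -/

section Zoom

variable {E : Type*} [NormedAddCommGroup E] [NormedSpace ℝ E]
  {F : Type*} [NormedAddCommGroup F] [NormedSpace ℝ F]
  {G : E → E →L[ℝ] E →L[ℝ] ℝ} {H : E → F} {V : Set E} {x : E} {c : ℝ}

/-- The zoom `ψ(w) = x + c w` has derivative `c • id` everywhere. [folklore] -/
theorem hasFDerivAt_zoom (x : E) (c : ℝ) (z : E) :
    HasFDerivAt (fun w : E ↦ x + c • w) (c • ContinuousLinearMap.id ℝ E) z :=
  ((hasFDerivAt_id z).const_smul c).const_add x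

/-- `fderiv` of the zoom. [folklore] -/
theorem fderiv_zoom (x : E) (c : ℝ) (z : E) :
    fderiv ℝ (fun w : E ↦ x + c • w) z = c • ContinuousLinearMap.id ℝ E :=
  (hasFDerivAt_zoom x c z).fderiv

/-- The zoom is smooth. [folklore] -/
theorem contDiff_zoom (x : E) (c : ℝ) : ContDiff ℝ ∞ (fun w : E ↦ x + c • w) :=
  contDiff_const.add (contDiff_const.smul contDiff_id)

/-- The zoom is a change of coordinates from `ψ⁻¹(V)` onto `V` (`c ≠ 0`). [folklore] -/
theorem isCoordChangeOn_zoom (hV : IsOpen V) (hc : c ≠ 0) :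
    IsCoordChangeOn (fun w : E ↦ x + c • w) ((fun w : E ↦ x + c • w) ⁻¹' V) V where
  isOpen := hV.preimage (contDiff_zoom x c).continuous
  contDiffOn := (contDiff_zoom x c).contDiffOn
  mapsTo := fun _ hz ↦ hz
  isInvertible := fun z _ ↦ by
    rw [fderiv_zoom x c z]
    refine ⟨ContinuousLinearEquiv.smulLeft (Units.mk0 c hc), ?_⟩
    ext v
    simp

/-- The zoomed components `G ∘ ψ` are metric components on `ψ⁻¹(V)`. [folklore] -/
theorem isMetricOn_comp_zoom (hG : IsMetricOn G V) (x : E) (c : ℝ) :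
    IsMetricOn (fun w : E ↦ G (x + c • w)) ((fun w : E ↦ x + c • w) ⁻¹' V) where
  isOpen := hG.isOpen.preimage (contDiff_zoom x c).continuous
  contDiffOn := hG.contDiffOn.comp (contDiff_zoom x c).contDiffOn fun _ hz ↦ hz
  symm := fun _ hz v w ↦ hG.symm _ hz v w
  isInvertible := fun _ hz ↦ hG.isInvertible _ hz

/-- `pullMetric G ψ = c² (G ∘ ψ)` for the zoom `ψ`. [folklore] -/
theorem pullMetric_zoom (x : E) (c : ℝ) :
    pullMetric G (fun w : E ↦ x + c • w) = fun w ↦ (c ^ 2) • G (x + c • w) := by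
  funext w
  ext v u
  rw [pullMetric_apply, fderiv_zoom]
  simp only [ContinuousLinearMap.id_apply, map_smul, smul_eq_mul, _root_.smul_apply]
  ring

variable [FiniteDimensional ℝ E] [CompleteSpace E]

/-- **Zoom covariance of the coordinate Ricci form**: `Ric(G ∘ ψ)(z) = c² Ric(G)(ψ z)` for
`ψ(w) = x + c w`, `c ≠ 0`, wherever `ψ z ∈ V` (naturality under the coordinate change `ψ`,
`ricAt_pullMetric`, and invariance under the constant factor `c²`, `IsMetricOn.ricAt_const_smul`).
O'Neill 1983, Ch. 3, Prop. 3.59; Hamilton 1997, §C2. [folklore] -/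
theorem ricAt_comp_zoom (hG : IsMetricOn G V) (hc : c ≠ 0) {z : E} (hz : x + c • z ∈ V)
    (Y Z : E) :
    ricAt (fun w : E ↦ G (x + c • w)) z Y Z = c ^ 2 * ricAt G (x + c • z) Y Z := by
  have hz' : z ∈ (fun w : E ↦ x + c • w) ⁻¹' V := hz
  have hG' := isMetricOn_comp_zoom hG x c
  have hc2 : c ^ 2 ≠ 0 := pow_ne_zero 2 hc
  have h1 := hG'.ricAt_const_smul hz' hc2 Y Z
  rw [← h1, ← pullMetric_zoom x c,
    ricAt_pullMetric hG (isCoordChangeOn_zoom hG.isOpen hc) hz' Y Z, fderiv_zoom]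
  simp only [ContinuousLinearMap.id_apply, map_smul, smul_eq_mul, _root_.smul_apply]
  ring

/-- The same as an identity of bilinear forms. [folklore] -/
theorem ricAt_comp_zoom_eq (hG : IsMetricOn G V) (hc : c ≠ 0) {z : E} (hz : x + c • z ∈ V) :
    ricAt (fun w : E ↦ G (x + c • w)) z = (c ^ 2) • ricAt G (x + c • z) := by
  ext Y Z
  rw [ricAt_comp_zoom hG hc hz]
  rfl

/-- **Zoom covariance of the derivative of the Ricci form**: `D[Ric(G ∘ ψ)](0) = c³ D[Ric G](x)`
for `ψ(w) = x + c w` (chain rule with `ricAt_comp_zoom` on the open set `ψ⁻¹(V) ∋ 0`).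
[folklore] -/
theorem fderiv_ricAt_comp_zoom (hG : IsMetricOn G V) (hx : x ∈ V) (hc : c ≠ 0) :
    fderiv ℝ (ricAt (fun w : E ↦ G (x + c • w))) 0 = (c ^ 3) • fderiv ℝ (ricAt G) x := by
  set ψ : E → E := fun w ↦ x + c • w with hψ
  have hψ0 : ψ 0 = x := by simp [hψ]
  have hopen : IsOpen (ψ ⁻¹' V) := hG.isOpen.preimage (contDiff_zoom x c).continuous
  have h0mem : (0 : E) ∈ ψ ⁻¹' V := by show ψ 0 ∈ V; rw [hψ0]; exact hx
  have heq : ricAt (fun w : E ↦ G (x + c • w)) =ᶠ[𝓝 0] fun z ↦ (c ^ 2) • ricAt G (ψ z) := by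
    filter_upwards [hopen.mem_nhds h0mem] with z hz
    exact ricAt_comp_zoom_eq hG hc hz
  rw [heq.fderiv_eq]
  have hR : DifferentiableAt ℝ (ricAt G) (ψ 0) := by
    rw [hψ0]; exact hG.differentiableAt_ricAt hx
  have hψd : DifferentiableAt ℝ ψ 0 := (hasFDerivAt_zoom x c 0).differentiableAt
  have hd : DifferentiableAt ℝ (fun z ↦ ricAt G (ψ z)) 0 := hR.comp 0 hψd
  have hcomp : fderiv ℝ (fun z ↦ ricAt G (ψ z)) 0 =
      (fderiv ℝ (ricAt G) x).comp (c • ContinuousLinearMap.id ℝ E) := by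
    rw [fderiv_fun_comp 0 hR hψd, fderiv_zoom, hψ0]
  rw [fderiv_fun_const_smul hd, hcomp]
  ext v Y Z
  simp only [_root_.smul_apply, ContinuousLinearMap.comp_apply, ContinuousLinearMap.id_apply,
    map_smul]
  rw [smul_smul]
  ring_nf

end Zoom

/-! ### Jets of zoomed fields -/

section ZoomJets

variable {E : Type*} [NormedAddCommGroup E] [NormedSpace ℝ E]
  {F : Type*} [NormedAddCommGroup F] [NormedSpace ℝ F]
  {H : E → F} {V : Set E} {x : E} {c : ℝ}

/-- **First jet of a zoomed field**: `D(H ∘ ψ)(z) = c • DH(ψ z)` for `ψ(w) = x + c w`, at every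
`z` with `ψ z` in the open set of smoothness of `H`. [folklore] -/
theorem fderiv_comp_zoom (hH : ContDiffOn ℝ ∞ H V) (hV : IsOpen V) {z : E} (hz : x + c • z ∈ V) :
    fderiv ℝ (fun w : E ↦ H (x + c • w)) z = c • fderiv ℝ H (x + c • z) := by
  have hHd : DifferentiableAt ℝ H (x + c • z) :=
    (hH.contDiffAt (hV.mem_nhds hz)).differentiableAt (by simp)
  have hψd : DifferentiableAt ℝ (fun w : E ↦ x + c • w) z := (hasFDerivAt_zoom x c z).differentiableAt
  rw [fderiv_fun_comp z hHd hψd, fderiv_zoom]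
  ext v
  simp

/-- The first jet identity as an equality of functions on the open set `ψ⁻¹(V)`. [folklore] -/
theorem fderiv_comp_zoom_eqOn (hH : ContDiffOn ℝ ∞ H V) (hV : IsOpen V) :
    EqOn (fderiv ℝ (fun w : E ↦ H (x + c • w))) (fun z ↦ c • fderiv ℝ H (x + c • z))
      ((fun w : E ↦ x + c • w) ⁻¹' V) :=
  fun _ hz ↦ fderiv_comp_zoom hH hV hz

/-- **Second jet of a zoomed field** on `ψ⁻¹(V)`: `D²(H ∘ ψ)(z) = c² • D²H(ψ z)`. [folklore] -/
theorem fderiv_fderiv_comp_zoom_of_mem [CompleteSpace F] (hH : ContDiffOn ℝ ∞ H V)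
    (hV : IsOpen V) {z : E} (hz : x + c • z ∈ V) :
    fderiv ℝ (fderiv ℝ (fun w : E ↦ H (x + c • w))) z = (c ^ 2) • fderiv ℝ (fderiv ℝ H) (x + c • z) := by
  have hopen : IsOpen ((fun w : E ↦ x + c • w) ⁻¹' V) := hV.preimage (contDiff_zoom x c).continuous
  have heq : fderiv ℝ (fun w : E ↦ H (x + c • w)) =ᶠ[𝓝 z]
      fun w ↦ c • fderiv ℝ H (x + c • w) :=
    Filter.eventually_of_mem (hopen.mem_nhds hz) (fderiv_comp_zoom_eqOn hH hV)
  rw [heq.fderiv_eq]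
  have hH' : ContDiffOn ℝ ∞ (fderiv ℝ H) V := hH.fderiv_of_isOpen hV (by simp)
  have hd : DifferentiableAt ℝ (fun w : E ↦ fderiv ℝ H (x + c • w)) z :=
    ((hH'.contDiffAt (hV.mem_nhds hz)).differentiableAt (by simp)).comp z
      (hasFDerivAt_zoom x c z).differentiableAt
  rw [fderiv_fun_const_smul hd, fderiv_comp_zoom hH' hV hz, smul_smul, sq]

/-- **Third jet of a zoomed field** at the base point: `D³(H ∘ ψ)(0) = c³ • D³H(x)`. [folklore] -/
theorem fderiv_fderiv_fderiv_comp_zoom [CompleteSpace F] (hH : ContDiffOn ℝ ∞ H V)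
    (hV : IsOpen V) (hx : x ∈ V) :
    fderiv ℝ (fderiv ℝ (fderiv ℝ (fun w : E ↦ H (x + c • w)))) 0 =
      (c ^ 3) • fderiv ℝ (fderiv ℝ (fderiv ℝ H)) x := by
  have hopen : IsOpen ((fun w : E ↦ x + c • w) ⁻¹' V) := hV.preimage (contDiff_zoom x c).continuous
  have h0 : x + c • (0 : E) ∈ V := by simpa using hx
  have heq : fderiv ℝ (fderiv ℝ (fun w : E ↦ H (x + c • w))) =ᶠ[𝓝 0]
      fun w ↦ (c ^ 2) • fderiv ℝ (fderiv ℝ H) (x + c • w) :=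
    Filter.eventually_of_mem (hopen.mem_nhds h0)
      fun _ hz ↦ fderiv_fderiv_comp_zoom_of_mem hH hV hz
  rw [heq.fderiv_eq]
  have hH' : ContDiffOn ℝ ∞ (fderiv ℝ H) V := hH.fderiv_of_isOpen hV (by simp)
  have hH'' : ContDiffOn ℝ ∞ (fderiv ℝ (fderiv ℝ H)) V := hH'.fderiv_of_isOpen hV (by simp)
  have hd : DifferentiableAt ℝ (fun w : E ↦ fderiv ℝ (fderiv ℝ H) (x + c • w)) 0 :=
    ((hH''.contDiffAt (hV.mem_nhds h0)).differentiableAt (by simp)).comp 0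
      (hasFDerivAt_zoom x c 0).differentiableAt
  rw [fderiv_fun_const_smul hd, fderiv_comp_zoom hH'' hV h0, smul_smul]
  simp only [smul_zero, add_zero]
  ring_nf

/-- The value and the first two jets of a zoomed field at the base point. [folklore] -/
theorem jets_comp_zoom [CompleteSpace F] (hH : ContDiffOn ℝ ∞ H V) (hV : IsOpen V) (hx : x ∈ V) :
    (fun w : E ↦ H (x + c • w)) 0 = H x ∧
      fderiv ℝ (fun w : E ↦ H (x + c • w)) 0 = c • fderiv ℝ H x ∧
      fderiv ℝ (fderiv ℝ (fun w : E ↦ H (x + c • w))) 0 = (c ^ 2) • fderiv ℝ (fderiv ℝ H) x := by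
  have h0 : x + c • (0 : E) ∈ V := by simpa using hx
  refine ⟨by simp, ?_, ?_⟩
  · rw [fderiv_comp_zoom hH hV h0]; simp
  · rw [fderiv_fderiv_comp_zoom_of_mem hH hV h0]; simp

/-- **Jets of a sum, up to order three**: for `H₁, H₂` smooth on an open `V ∋ x`, the first three
nested derivatives of `H₁ + H₂` at `x` are the sums of those of `H₁` and `H₂`. [folklore] -/
theorem fderiv_add_jets [CompleteSpace F] {H₁ H₂ : E → F} (h₁ : ContDiffOn ℝ ∞ H₁ V)
    (h₂ : ContDiffOn ℝ ∞ H₂ V) (hV : IsOpen V) (hx : x ∈ V) :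
    fderiv ℝ (fun z ↦ H₁ z + H₂ z) x = fderiv ℝ H₁ x + fderiv ℝ H₂ x ∧
      fderiv ℝ (fderiv ℝ (fun z ↦ H₁ z + H₂ z)) x =
        fderiv ℝ (fderiv ℝ H₁) x + fderiv ℝ (fderiv ℝ H₂) x ∧
      fderiv ℝ (fderiv ℝ (fderiv ℝ (fun z ↦ H₁ z + H₂ z))) x =
        fderiv ℝ (fderiv ℝ (fderiv ℝ H₁)) x + fderiv ℝ (fderiv ℝ (fderiv ℝ H₂)) x := by
  have hd : ∀ {H : E → F}, ContDiffOn ℝ ∞ H V → ∀ z ∈ V, DifferentiableAt ℝ H z :=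
    fun hH z hz ↦ (hH.contDiffAt (hV.mem_nhds hz)).differentiableAt (by simp)
  have h₁' : ContDiffOn ℝ ∞ (fderiv ℝ H₁) V := h₁.fderiv_of_isOpen hV (by simp)
  have h₂' : ContDiffOn ℝ ∞ (fderiv ℝ H₂) V := h₂.fderiv_of_isOpen hV (by simp)
  have h₁'' : ContDiffOn ℝ ∞ (fderiv ℝ (fderiv ℝ H₁)) V := h₁'.fderiv_of_isOpen hV (by simp)
  have h₂'' : ContDiffOn ℝ ∞ (fderiv ℝ (fderiv ℝ H₂)) V := h₂'.fderiv_of_isOpen hV (by simp)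
  have e1 : EqOn (fderiv ℝ (fun z ↦ H₁ z + H₂ z)) (fun z ↦ fderiv ℝ H₁ z + fderiv ℝ H₂ z) V :=
    fun z hz ↦ fderiv_fun_add (hd h₁ z hz) (hd h₂ z hz)
  have e2 : EqOn (fderiv ℝ (fderiv ℝ (fun z ↦ H₁ z + H₂ z)))
      (fun z ↦ fderiv ℝ (fderiv ℝ H₁) z + fderiv ℝ (fderiv ℝ H₂) z) V := by
    intro z hz
    have hev : fderiv ℝ (fun z ↦ H₁ z + H₂ z) =ᶠ[𝓝 z] fun z ↦ fderiv ℝ H₁ z + fderiv ℝ H₂ z :=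
      Filter.eventually_of_mem (hV.mem_nhds hz) e1
    rw [hev.fderiv_eq]
    exact fderiv_fun_add ((h₁'.contDiffAt (hV.mem_nhds hz)).differentiableAt (by simp))
      ((h₂'.contDiffAt (hV.mem_nhds hz)).differentiableAt (by simp))
  have e3 : fderiv ℝ (fderiv ℝ (fderiv ℝ (fun z ↦ H₁ z + H₂ z))) x =
      fderiv ℝ (fderiv ℝ (fderiv ℝ H₁)) x + fderiv ℝ (fderiv ℝ (fderiv ℝ H₂)) x := by
    have hev : fderiv ℝ (fderiv ℝ (fun z ↦ H₁ z + H₂ z)) =ᶠ[𝓝 x]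
        fun z ↦ fderiv ℝ (fderiv ℝ H₁) z + fderiv ℝ (fderiv ℝ H₂) z :=
      Filter.eventually_of_mem (hV.mem_nhds hx) e2
    rw [hev.fderiv_eq]
    exact fderiv_fun_add ((h₁''.contDiffAt (hV.mem_nhds hx)).differentiableAt (by simp))
      ((h₂''.contDiffAt (hV.mem_nhds hx)).differentiableAt (by simp))
  exact ⟨e1 hx, e2 hx, e3⟩

end ZoomJets

/-! ### The chain rule through the Ricci jet function -/

section JetMap

set_option maxSynthPendingDepth 6
set_option synthInstance.maxHeartbeats 200000

variable {E : Type*} [NormedAddCommGroup E] [NormedSpace ℝ E] [FiniteDimensional ℝ E]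
  [CompleteSpace E] {G : E → E →L[ℝ] E →L[ℝ] ℝ} {V : Set E} {x : E}

omit [FiniteDimensional ℝ E] [CompleteSpace E] in
/-- The `2`-jet map `y ↦ (y, G y, DG y, D²G y)` of smooth components has derivative
`v ↦ (v, DG(x) v, D²G(x) v, D³G(x) v)` at `x`. [folklore] -/
theorem hasFDerivAt_jetMap (hG : ContDiffOn ℝ ∞ G V) (hV : IsOpen V) (hx : x ∈ V) :
    HasFDerivAt (fun y : E ↦ (y, G y, fderiv ℝ G y, fderiv ℝ (fderiv ℝ G) y))
      ((ContinuousLinearMap.id ℝ E).prod ((fderiv ℝ G x).prod ((fderiv ℝ (fderiv ℝ G) x).prod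
        (fderiv ℝ (fderiv ℝ (fderiv ℝ G)) x)))) x := by
  have hG' : ContDiffOn ℝ ∞ (fderiv ℝ G) V := hG.fderiv_of_isOpen hV (by simp)
  have hG'' : ContDiffOn ℝ ∞ (fderiv ℝ (fderiv ℝ G)) V := hG'.fderiv_of_isOpen hV (by simp)
  have h1 : HasFDerivAt G (fderiv ℝ G x) x :=
    ((hG.contDiffAt (hV.mem_nhds hx)).differentiableAt (by simp)).hasFDerivAt
  have h2 : HasFDerivAt (fderiv ℝ G) (fderiv ℝ (fderiv ℝ G) x) x :=
    ((hG'.contDiffAt (hV.mem_nhds hx)).differentiableAt (by simp)).hasFDerivAt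
  have h3 : HasFDerivAt (fderiv ℝ (fderiv ℝ G)) (fderiv ℝ (fderiv ℝ (fderiv ℝ G)) x) x :=
    ((hG''.contDiffAt (hV.mem_nhds hx)).differentiableAt (by simp)).hasFDerivAt
  have h23 : HasFDerivAt (fun y : E ↦ (fderiv ℝ G y, fderiv ℝ (fderiv ℝ G) y))
      ((fderiv ℝ (fderiv ℝ G) x).prod (fderiv ℝ (fderiv ℝ (fderiv ℝ G)) x)) x := h2.prodMk h3
  have h123 : HasFDerivAt (fun y : E ↦ (G y, fderiv ℝ G y, fderiv ℝ (fderiv ℝ G) y))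
      ((fderiv ℝ G x).prod ((fderiv ℝ (fderiv ℝ G) x).prod (fderiv ℝ (fderiv ℝ (fderiv ℝ G)) x))) x :=
    h1.prodMk h23
  exact (hasFDerivAt_id x).prodMk h123

/-- **`D[Ric G](x)` through the Ricci jet function**: for metric components `G` on `V ∋ x`,
`D[Ric G](x) = D(ricciJet)(x, G x, DG x, D²G x) ∘ (v ↦ (v, DG v, D²G v, D³G v))`
(`ricAt_eq_ricciJet` on the open set `V`, smoothness of `ricciJet` on its open domain,
`contDiffOn_ricciJet`, and the chain rule). [folklore] -/
theorem fderiv_ricAt_eq_comp_jetMap (hG : IsMetricOn G V) (hx : x ∈ V) :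
    fderiv ℝ (ricAt G) x = (fderiv ℝ (ricciJet (E := E))
        (x, G x, fderiv ℝ G x, fderiv ℝ (fderiv ℝ G) x)).comp
      ((ContinuousLinearMap.id ℝ E).prod ((fderiv ℝ G x).prod ((fderiv ℝ (fderiv ℝ G) x).prod
        (fderiv ℝ (fderiv ℝ (fderiv ℝ G)) x)))) := by
  have heq : ricAt G =ᶠ[𝓝 x]
      (ricciJet (E := E)) ∘ fun y : E ↦ (y, G y, fderiv ℝ G y, fderiv ℝ (fderiv ℝ G) y) := by
    filter_upwards [hG.isOpen.mem_nhds hx] with y hy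
    exact ricAt_eq_ricciJet hG hy
  rw [heq.fderiv_eq]
  have hmem : (x, G x, fderiv ℝ G x, fderiv ℝ (fderiv ℝ G) x) ∈
      {j : E × (E →L[ℝ] E →L[ℝ] ℝ) × (E →L[ℝ] E →L[ℝ] E →L[ℝ] ℝ) ×
        (E →L[ℝ] E →L[ℝ] E →L[ℝ] E →L[ℝ] ℝ) | j.2.1.IsInvertible} := hG.isInvertible x hx
  have hR : DifferentiableAt ℝ (ricciJet (E := E)) (x, G x, fderiv ℝ G x, fderiv ℝ (fderiv ℝ G) x) :=
    (contDiffOn_ricciJet.contDiffAt (isOpen_ricciJetDomain.mem_nhds hmem)).differentiableAt (by simp)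
  have hJ := hasFDerivAt_jetMap hG.contDiffOn hG.isOpen hx
  exact (hR.hasFDerivAt.comp x hJ).fderiv

omit [FiniteDimensional ℝ E] [CompleteSpace E] in
/-- Norm of a jet map `v ↦ (v, D₁ v, D₂ v, D₃ v)` (sup norm on the product): `≤ 1` as soon as
`‖D₁‖, ‖D₂‖, ‖D₃‖ ≤ 1`. [folklore] -/
theorem norm_jetCLM_le {F₁ F₂ F₃ : Type*} [NormedAddCommGroup F₁] [NormedSpace ℝ F₁]
    [NormedAddCommGroup F₂] [NormedSpace ℝ F₂] [NormedAddCommGroup F₃] [NormedSpace ℝ F₃]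
    (D₁ : E →L[ℝ] F₁) (D₂ : E →L[ℝ] F₂) (D₃ : E →L[ℝ] F₃)
    (h₁ : ‖D₁‖ ≤ 1) (h₂ : ‖D₂‖ ≤ 1) (h₃ : ‖D₃‖ ≤ 1) :
    ‖(ContinuousLinearMap.id ℝ E).prod (D₁.prod (D₂.prod D₃))‖ ≤ 1 := by
  refine ContinuousLinearMap.opNorm_le_bound _ zero_le_one fun v ↦ ?_
  rw [one_mul]
  simp only [ContinuousLinearMap.prod_apply, ContinuousLinearMap.id_apply, Prod.norm_def]
  refine max_le le_rfl (max_le ?_ (max_le ?_ ?_))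
  · exact (D₁.le_opNorm v).trans (by nlinarith [norm_nonneg v])
  · exact (D₂.le_opNorm v).trans (by nlinarith [norm_nonneg v])
  · exact (D₃.le_opNorm v).trans (by nlinarith [norm_nonneg v])

omit [FiniteDimensional ℝ E] [CompleteSpace E] in
/-- Norm of the difference of two jet maps: `≤ δ` as soon as the three components differ by
`≤ δ`. [folklore] -/
theorem norm_jetCLM_sub_le {F₁ F₂ F₃ : Type*} [NormedAddCommGroup F₁] [NormedSpace ℝ F₁]
    [NormedAddCommGroup F₂] [NormedSpace ℝ F₂] [NormedAddCommGroup F₃] [NormedSpace ℝ F₃]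
    (D₁ D₁' : E →L[ℝ] F₁) (D₂ D₂' : E →L[ℝ] F₂) (D₃ D₃' : E →L[ℝ] F₃) {δ : ℝ} (hδ : 0 ≤ δ)
    (h₁ : ‖D₁ - D₁'‖ ≤ δ) (h₂ : ‖D₂ - D₂'‖ ≤ δ) (h₃ : ‖D₃ - D₃'‖ ≤ δ) :
    ‖(ContinuousLinearMap.id ℝ E).prod (D₁.prod (D₂.prod D₃)) -
      (ContinuousLinearMap.id ℝ E).prod (D₁'.prod (D₂'.prod D₃'))‖ ≤ δ := by
  refine ContinuousLinearMap.opNorm_le_bound _ hδ fun v ↦ ?_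
  simp only [_root_.sub_apply, ContinuousLinearMap.prod_apply,
    ContinuousLinearMap.id_apply, Prod.mk_sub_mk, sub_self, Prod.norm_def, norm_zero]
  refine max_le (by positivity) (max_le ?_ (max_le ?_ ?_))
  · rw [← _root_.sub_apply]
    exact ((D₁ - D₁').le_opNorm v).trans (mul_le_mul_of_nonneg_right h₁ (norm_nonneg v))
  · rw [← _root_.sub_apply]
    exact ((D₂ - D₂').le_opNorm v).trans (mul_le_mul_of_nonneg_right h₂ (norm_nonneg v))
  · rw [← _root_.sub_apply]
    exact ((D₃ - D₃').le_opNorm v).trans (mul_le_mul_of_nonneg_right h₃ (norm_nonneg v))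

end JetMap

/-- **Registered one-line carrier form** (`slaving_fderiv_ricAt_comp_zoom_slaving12`) of
`fderiv_ricAt_comp_zoom` in the lab chart `E4`: `D[Ric(G ∘ ψ)](0) = c³ D[Ric G](x)` for the zoom
`ψ(w) = x + c w`. [folklore] -/
theorem slaving_fderiv_ricAt_comp_zoom_slaving12 : open Literature.Geometry.Lorentzian in ∀ {G : E4 → E4 →L[ℝ] E4 →L[ℝ] ℝ} {V : Set E4} {x : E4} {c : ℝ}, MetricCoord.IsMetricOn G V → x ∈ V → c ≠ 0 → fderiv ℝ (MetricCoord.ricAt (fun w : E4 ↦ G (x + c • w))) 0 = (c ^ 3) • fderiv ℝ (MetricCoord.ricAt G) x :=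
  fun hG hx hc ↦ fderiv_ricAt_comp_zoom hG hx hc

end Summit.FinalStateConjecture.FinalStateConjecture.Theorems.SublinearIsFree.Slaving

end
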